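import Literature.NumberTheory.Automorphic.QuaternionGLTwoTorusComparison
import Literature.NumberTheory.Automorphic.QuaternionUnitsClassTerm
import Literature.NumberTheory.Automorphic.GLTwoEllipticClassTerm
import HarnessLib

/-!
# Term-by-term comparison of the elliptic parts of (10.14) and (10.15)
(Gelbart, *Automorphic forms on adele groups* (1975), pp. 154–155: "To complete the proof of
Theorem 10.5 we shall exploit (10.8) … to show that (10.14) and (10.15) are equal" — class by
class, the volume factors being equal and the orbital integrals being matched by (10.19)–(10.22))

Topic `NumberTheory/Automorphic`; theorems only (no definition, no named fact, no instance). The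
shape of Gelbart's comparison of one elliptic term of the `GL(2)` trace formula (10.15) with the
corresponding term of the `D^×` trace formula (10.14), assembled from

* `units_lintegral_conjTsum_conjOrbit_eq_covol_mul` (`QuaternionUnitsClassTerm`): the `D^×` term of
  the class of `γ'` is `c'_μ · vol(C(γ') ⧸ H') · O_{γ'}(F')`;
* `glTwo_lintegral_conjTsum_conjOrbit_eq_covol_mul` (`GLTwoEllipticClassTerm`): the `GL(2)` term of
  the class of an elliptic `γ` is `c_μ · vol(C(γ) ⧸ H) · O_γ(F)`;
* `quaternion_glTwo_volumeFactor_eq` (`QuaternionGLTwoTorusComparison`): for matching classes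
  (`(trd, nrd)(γ') = (tr, det)(γ)`) and Haar-type measures corresponding under
  `Ψ = quaternionGlTwoCentralizerAdelicEquiv : C(γ') ≃ₜ* C(γ)`, `vol(C(γ) ⧸ H) = vol(C(γ') ⧸ H')`.

`quaternion_glTwo_classTerm_eq`: **if moreover the normalising constants agree (`c_μ = c'_μ`) and the
orbital integrals agree (`O_γ(F) = O_{γ'}(F')` — Gelbart's (10.19)–(10.21), the local content of the
comparison, here an explicit hypothesis), then the two class terms are equal.** Nothing is hidden in
the hypotheses beyond what Gelbart proves locally: the measure correspondence is the Tamagawa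
normalisation of p. 155 restricted to the tori, the orbital-integral identity is (10.19)–(10.21)
with (10.8). A brick of the inline (D-0026) decomposition of
`Literature.NumberTheory.Automorphic.strong_multiplicity_one_quaternionUnits` (Gelbart Thm. 10.5).

## References

* S. Gelbart, *Automorphic forms on adele groups*, Ann. of Math. Studies 83 (1975), pp. 154–155,
  (10.14)–(10.22) [Gelbart1975].
-/

noncomputable section

open scoped NNReal ENNReal
open NumberField IsDedekindDomain MeasureTheory Measure Topology Matrix
open Literature.MeasureTheory.Group

namespace Literature.NumberTheory.Automorphic

-- the coset spaces carry Borel σ-algebras supplied locally, not the quotient σ-algebra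
attribute [-instance] Quotient.instMeasurableSpace QuotientGroup.measurableSpace

section Comparison

universe u

variable (K : Type) [Field K] [NumberField K] (D : Type u) [Ring D] [Algebra K D] [IsQuaternionAlgebra K D]
  (γ' : Dˣ) (γ : GL (Fin 2) K)

/-- The adelic group datum of `D^×`. -/
local notation "GD" => AdelicGroupData.units K D
/-- The adelic group datum of `GL₂`. -/
local notation "G2" => AdelicGroupData.gl 2 K
/-- `C(γ') ≤ D_𝔸ˣ`. -/
local notation "Cq" => Subgroup.centralizer ({AdelicGroupData.toAdelic (AdelicGroupData.units K D) γ'} :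
  Set (AdelicGroupData.Adelic (AdelicGroupData.units K D)))
/-- `C(γ) ≤ GL₂(𝔸_K)`. -/
local notation "Cg" => Subgroup.centralizer ({AdelicGroupData.toAdelic (AdelicGroupData.gl 2 K) γ} :
  Set (AdelicGroupData.Adelic (AdelicGroupData.gl 2 K)))

attribute [local instance] AdelicGroupData.measurableSpaceQuotientForm
  AdelicGroupData.borelSpaceQuotientForm AdelicGroupData.smulInvariantMeasureQuotientForm
  AdelicGroupData.isFiniteMeasureOnCompactsQuotientForm AdelicGroupData.isFiniteMeasureQuotientForm

/-- **One elliptic term of (10.15) equals the corresponding term of (10.14)** (Gelbart (1975),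
pp. 154–155). Data: a division quaternion algebra `D` over the number field `K`; `γ' ∈ Dˣ` and an
elliptic `γ ∈ GL₂(K)` with `trd γ' = tr γ`, `nrd γ' = det γ` (matching classes); automorphic
measures `μ'` on `X' = D_𝔸ˣ ⧸ ℝ_{>0} Dˣ` and `μ` on `X = GL₂(𝔸_K) ⧸ ℝ_{>0} GL₂(K)`; two-sided Haar
measures `ν'`, `ν`; Haar measures `ρ'_L`, `ρ_L` on `ℝ_{>0} Dˣ`, `ℝ_{>0} GL₂(K)`, their restrictions
`ρ'_H`, `ρ_H` to `H' = ℝ_{>0} Dˣ ∩ C(γ')`, `H = ℝ_{>0} GL₂(K) ∩ C(γ)` and transports `ρ'_F`, `ρ_F`;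
Haar measures `ν'_C` on `C(γ')` and `ν_C` on `C(γ)`; test functions `F' : D_𝔸ˣ → [0, ∞]`,
`F : GL₂(𝔸_K) → [0, ∞]`. Hypotheses: the torus measures correspond under
`Ψ = quaternionGlTwoCentralizerAdelicEquiv` (`hν`, `hρ`: then the volume factors agree,
`quaternion_glTwo_volumeFactor_eq`), the normalising constants agree (`hc : c_μ = c'_μ`) and the
orbital integrals agree (`horb`: Gelbart's (10.19)–(10.21)). Conclusion: the class term of `γ` in the
`GL(2)` geometric side equals the class term of `γ'` in the `D^×` geometric side:
`∫_X Σ'_{s ∈ [γ]} F(x̃ s x̃⁻¹) dμ = ∫_{X'} Σ'_{s' ∈ [γ']} F'(x̃' s' x̃'⁻¹) dμ'`.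
[cite: Gelbart1975, pp. 154–155] -/
theorem quaternion_glTwo_classTerm_eq (hD : ∀ x : D, x ≠ 0 → IsUnit x)
    (hγ : Irreducible (γ : Matrix (Fin 2) (Fin 2) K).charpoly)
    (ht : reducedTrace K D (γ' : D) = (γ : Matrix (Fin 2) (Fin 2) K).trace)
    (hn : reducedNorm K D (γ' : D) = (γ : Matrix (Fin 2) (Fin 2) K).det)
    -- the `GL(2)` side
    [MeasurableSpace (G2).Adelic] [BorelSpace (G2).Adelic]
    [LocallyCompactSpace (G2).Adelic] [SecondCountableTopology (G2).Adelic] [T2Space (G2).Adelic]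
    [hH : IsClosed ((G2).quotientSubgroup : Set (G2).Adelic)]
    [hC : IsClosed ((Cg : Subgroup (G2).Adelic) : Set (G2).Adelic)]
    [MeasurableSpace ((G2).Adelic ⧸ Cg)] [BorelSpace ((G2).Adelic ⧸ Cg)]
    [MeasurableSpace (↥Cg ⧸ ((G2).quotientSubgroup ⊓ Cg).subgroupOf Cg)]
    [BorelSpace (↥Cg ⧸ ((G2).quotientSubgroup ⊓ Cg).subgroupOf Cg)]
    (μ : Measure (G2).automorphicQuotient) [(G2).IsAutomorphicMeasure μ]
    (ν : Measure (G2).Adelic) [IsHaarMeasure ν] [ν.IsMulRightInvariant]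
    (ρL : Measure (G2).quotientSubgroup) [ρL.IsHaarMeasure] [SFinite ρL]
    (ρH : Measure ↥((G2).quotientSubgroup ⊓ Cg)) [IsHaarMeasure ρH] [ρH.IsInvInvariant] [SFinite ρH]
    (ρF : Measure ↥(((G2).quotientSubgroup ⊓ Cg).subgroupOf Cg))
    [IsHaarMeasure ρF] [ρF.IsInvInvariant] [SFinite ρF]
    (νC : Measure Cg) [IsHaarMeasure νC] [νC.IsMulRightInvariant] [νC.IsInvInvariant] [SFinite νC]
    (hρH : ρH = ρL.comap (Subgroup.inclusion inf_le_left))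
    (hρF : ρF = Measure.map (Subgroup.subgroupOfEquivOfLe inf_le_right).symm ρH)
    {F : (G2).Adelic → ℝ≥0∞} (hF : Measurable F)
    -- the `D^×` side
    [MeasurableSpace (GD).Adelic] [BorelSpace (GD).Adelic]
    [LocallyCompactSpace (GD).Adelic] [SecondCountableTopology (GD).Adelic] [T2Space (GD).Adelic]
    [hH' : IsClosed ((GD).quotientSubgroup : Set (GD).Adelic)]
    [hC' : IsClosed ((Cq : Subgroup (GD).Adelic) : Set (GD).Adelic)]
    [MeasurableSpace ((GD).Adelic ⧸ Cq)] [BorelSpace ((GD).Adelic ⧸ Cq)]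
    [MeasurableSpace (↥Cq ⧸ ((GD).quotientSubgroup ⊓ Cq).subgroupOf Cq)]
    [BorelSpace (↥Cq ⧸ ((GD).quotientSubgroup ⊓ Cq).subgroupOf Cq)]
    (μ' : Measure (GD).automorphicQuotient) [(GD).IsAutomorphicMeasure μ']
    (ν' : Measure (GD).Adelic) [IsHaarMeasure ν'] [ν'.IsMulRightInvariant]
    (ρL' : Measure (GD).quotientSubgroup) [ρL'.IsHaarMeasure] [SFinite ρL']
    (ρH' : Measure ↥((GD).quotientSubgroup ⊓ Cq)) [IsHaarMeasure ρH'] [ρH'.IsInvInvariant] [SFinite ρH']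
    (ρF' : Measure ↥(((GD).quotientSubgroup ⊓ Cq).subgroupOf Cq))
    [IsHaarMeasure ρF'] [ρF'.IsInvInvariant] [SFinite ρF']
    (νC' : Measure Cq) [IsHaarMeasure νC'] [νC'.IsMulRightInvariant] [νC'.IsInvInvariant] [SFinite νC']
    (hρH' : ρH' = ρL'.comap (Subgroup.inclusion inf_le_left))
    (hρF' : ρF' = Measure.map (Subgroup.subgroupOfEquivOfLe inf_le_right).symm ρH')
    {F' : (GD).Adelic → ℝ≥0∞} (hF' : Measurable F')
    -- the comparison hypotheses
    (hν : νC = Measure.map (quaternionGlTwoCentralizerAdelicEquiv K D γ' γ hD hγ ht hn) νC')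
    (hρ : ρF = Measure.map (subgroupCongrHomeomorph
      (quaternionGlTwoCentralizerAdelicEquiv K D γ' γ hD hγ ht hn).toMulEquiv
      (((GD).quotientSubgroup ⊓ Cq).subgroupOf Cq) (((G2).quotientSubgroup ⊓ Cg).subgroupOf Cg)
      (quaternionGlTwoCentralizerAdelicEquiv_mem_iff K D γ' γ hD hγ ht hn)
      (quaternionGlTwoCentralizerAdelicEquiv K D γ' γ hD hγ ht hn).continuous
      (quaternionGlTwoCentralizerAdelicEquiv K D γ' γ hD hγ ht hn).symm.continuous) ρF')
    (hc : unfoldingConstant (G2).quotientSubgroup ρL μ ν = unfoldingConstant (GD).quotientSubgroup ρL' μ' ν')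
    (horb : ∫⁻ y, descConj ((G2).toAdelic γ) Cg (mem_centralizer_singleton_comm _) F y
        ∂quotientMeasure Cg νC hC ν =
      ∫⁻ y, descConj ((GD).toAdelic γ') Cq (mem_centralizer_singleton_comm _) F' y
        ∂quotientMeasure Cq νC' hC' ν') :
    ∫⁻ x, conjTsum (G2).quotientSubgroup (conjOrbit (G2).arithmeticSubgroup ((G2).toAdelic γ))
        (conj_mem_conjOrbit_of_exists (G2).arithmeticSubgroup (G2).quotientSubgroup
          (AdelicGroupData.exists_inv_mul_mem_centralizer_quotientSubgroup (G2)) ⟨γ, rfl⟩) F x ∂μ =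
      ∫⁻ x, conjTsum (GD).quotientSubgroup (conjOrbit (GD).arithmeticSubgroup ((GD).toAdelic γ'))
        (conj_mem_conjOrbit_of_exists (GD).arithmeticSubgroup (GD).quotientSubgroup
          (AdelicGroupData.exists_inv_mul_mem_centralizer_quotientSubgroup (GD)) ⟨γ', rfl⟩) F' x ∂μ' := by
  rw [glTwo_lintegral_conjTsum_conjOrbit_eq_covol_mul K γ hγ μ ν ρL ρH ρF νC hρH hρF hF,
    units_lintegral_conjTsum_conjOrbit_eq_covol_mul K D γ' hD μ' ν' ρL' ρH' ρF' νC' hρH' hρF' hF',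
    quaternion_glTwo_volumeFactor_eq K D γ' γ hD hγ ht hn νC ρF νC' ρF' hν hρ, hc, horb]

end Comparison

end Literature.NumberTheory.Automorphic
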